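import Summits.BirchSwinnertonDyer.Rank1Residual.Additive.KatoDescentClosedBindersContra
import Summits.BirchSwinnertonDyer.Rank1Residual.Additive.KatoDescentTorsionFreeReadings
import Literature.NumberTheory.EllipticCurves.Kato2004.IwasawaH2DescentRankOne
import Literature.NumberTheory.EllipticCurves.LeadingTerm
import HarnessLib

set_option autoImplicit false

/-!
# Stub 3 `stub_rankOneCountReadingKato` of the Kato–Perrin-Riou skeletons v4, conjunct (i): at the PRINT-EXACT
# (contragredient) closed binders the `𝐇²`-coinvariants of a realised descent datum are FINITE on every rank-one
# `Ш[p^∞]`-finite row — from cell bsd-cn100's named fact `Kato2004.finite_descentCokernel_of_rankOne` and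
# Gross–Zagier–Kolyvagin, hypothesis-shaped exactly as the stub (seat `bsd-cm-prr-ty1` g7, cell `bsd-cm`; theorems
# only: no definition, no named fact, no instance, no `sorry`)

WHAT. Stub 3 of both registered skeletons (planner D414; cruxes stmt-BirchSwinnertonDyer-19945
`Cruxes/EllipticUnitValueSevenOfGZK/Lines/kato_perrin_riou_zp.lean`, stmt-BirchSwinnertonDyer-19223
`Cruxes/CccOneLawOnTypeIstarZero/Lines/kato_perrin_riou_istar.lean`; also cell bsd-potss's held input 27322) is
the hypothesis schema `TorsionFree.RankOneCountReading IsKatoZetaDescentDatumOfContra Kato2004.PRRatio`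
(`KatoDescentTorsionFreeReadings.lean` §1, reading 1″♭): for `W/ℚ` globally minimal of analytic rank `1`, `p ≠ 2`
additive potentially good, `p ∤ #W(ℚ)_tors`, `Ш(W)` finite, a datum `D` with `IsKatoZetaDescentDatumOfContra W p D`
and a ratio `ℒ` with `Kato2004.PRRatio W p ℒ`:
(i) `Finite (coinvariants p D.H2)` ∧ (ii) `ℒ ≠ 0 ↔ D.zetaIndex ≠ 0` ∧ (iii) `[A : z] = p^m·#(D.H2)_Γ →
v_p ℒ = m + ord_p #Ш + ord_p Tam`.

THIS FILE proves CONJUNCT (i) in the kernel from two named Literature inputs and nothing else: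
* `Kato2004.finite_descentCokernel_of_rankOne` (cell bsd-cn100's named fact, `Kato2004/IwasawaH2DescentRankOne.lean`:
  on a rank-one `Ш[p^∞]`-finite row the image of `proj₀ : 𝐇¹_Γ/T → H¹(ℤ[1/p], T_pW)` has finite index; its PROVED
  consumer form `IwasawaH2Data.finite_coinvariants_H2_of_rankOne` gives `𝐇²_Γ/T·𝐇²_Γ` finite on every descent
  package) [cite: Kato2004Asterisque, §14.14 (14.14.1)–(14.14.2) (p. 243), §14.9 (14.9.3) (p. 240)];
* `rank_eq_analyticRank_of_analyticRank_le_one` (Gross–Zagier–Kolyvagin, `LeadingTerm.lean`: `r_an ≤ 1 ⇒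
  rank = r_an ∧ Ш finite`) [cite: Darmon2004, Thm. 3.22];
through the pin of the closed `IsOf`: `IsKatoZetaDescentDatumOfContra W p D` provides `P : KatoDescentDatumPinH2 W p D`
with `P.κ` cyclotomic, `P.γ` a topological generator, the package `P.J : IwasawaH2Data W p P.κ P.γ P.I` and
`P.eH2 : D.H2 ≃ₗ[Λ] P.J.H2`, along which the finiteness of the coinvariants is transported (`coinvariantsEquiv`).

RESIDUAL OF STUB 3 after this file (the seat's cut, `HOME/bsd-cm-prr-ty1/STUB3-CUT.md` of cell bsd-cm): conjuncts
(ii)/(iii) need, besides the two inputs above, (I3) the `ℤ_p`-linearity/uniqueness of the Kummer logarithm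
`Kato2004.HasLocPKummerLog` on `H¹(ℤ[1/p], T_pW)` in rank one (Bloch–Kato Ex. 3.11 + Kato (14.9.3)), (I4) Kato's
independence of the zeta element from the choices (§13.9, p. 230: two value-pinned families' Λ-adic lifts are
proportional by their explicit constants), (I5) the canonical rank-one Poitou–Tate count over the pinned
(`𝐇¹_Γ`, `𝐇²_Γ`) — none of which is in the tree as a theorem; the `e`-bookkeeping linking `Kato2004.PRRatio`'s
normalisation to `IsAdmissibleZetaClass`'s is the kernel theorem
`Kato2004.IsAdmissibleZetaClass.exists_proj_zero_position` (`Kato2004/AdmissibleZetaClassBottomLayerProofs.lean`).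

HONEST LABEL: conditional reductions on displayed hypotheses (one unproved named Literature fact, one held print
input); no stub or item is closed; nothing is registered; nothing is asserted on 19945 / 19223; Kato's Main
Conjecture and Perrin-Riou's conjecture are not touched; BSD is not proved for any curve. `Summits/…/Theorems/`
being prover-only (D-0016), the file lives next to the binders it serves.
-/

noncomputable section

open scoped Classical NumberField

open WeierstrassCurve Field Literature.NumberTheory.EllipticCurves
  Literature.NumberTheory.EllipticCurves.Kato2004 Literature.NumberTheory.EllipticCurves.IwasawaAlgebra
  Literature.NumberTheory.GaloisRepresentations
open Summit.BirchSwinnertonDyer.BirchSwinnertonDyer.Theorems.CongruentShaFreeCutKatoDescentDatumOfH2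

namespace Summit.BirchSwinnertonDyer.Rank1Residual.Additive.ContraCount

/-! ## §1 Conjunct (i) on a realised contragredient datum: `(D.H2)_Γ` finite on rank-one `Ш[p^∞]`-finite rows -/

/-- **`(D.H2)/T·(D.H2)` is finite** for a datum `D` with `IsKatoZetaDescentDatumOfContra W p D`, when
`rank_ℤ W(ℚ) = 1` and `Ш(W)[p^∞]` is finite — from cn100's named fact `Kato2004.finite_descentCokernel_of_rankOne`
(its consumer form `IwasawaH2Data.finite_coinvariants_H2_of_rankOne` on the pin's package `P.J`, transported along
`P.eH2 : D.H2 ≃ P.J.H2`). The admissibility and (H2ᶜ) clauses of the closed `IsOf` are not used: only the pin.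
[cite: Kato2004Asterisque, §14.14 (14.14.1)–(14.14.2) (p. 243), §14.9 (14.9.3) (p. 240)]
[cite: AlpogeBhargavaShnidman2022, App. A §10.1.3 (printed instance)] -/
theorem finite_coinvariants_H2_of_isKatoZetaDescentDatumOfContra
    (hfd : Kato2004.finite_descentCokernel_of_rankOne)
    {W : WeierstrassCurve ℚ} [W.IsElliptic] [W.IsGloballyMinimal] {p : ℕ} [Fact p.Prime]
    {D : KatoDescentDatum p} (hD : IsKatoZetaDescentDatumOfContra W p D)
    (hrank : W.mordellWeilRank = 1) (hsha : Finite (AddCommGroup.primaryComponent W.sha p)) :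
    Finite (coinvariants p D.H2) := by
  letI : ContinuousSMul ℤ_[p] (W.tateModule p) := TateModule.continuousSMul_padicInt
  obtain ⟨P, -, -⟩ := hD
  haveI : Finite (coinvariants p P.J.H2) :=
    IwasawaH2Data.finite_coinvariants_H2_of_rankOne hfd P.isCyclotomic P.isTopGenerator P.J hrank hsha
  exact Finite.of_equiv _ (coinvariantsEquiv P.eH2).toEquiv.symm

/-- **Conjunct (i) of stub 3, hypothesis-shaped as the stub** (the binders of
`TorsionFree.RankOneCountReading IsKatoZetaDescentDatumOfContra Kato2004.PRRatio` that it uses: `r_an(W) = 1`,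
`Ш(W)` finite, the closed `IsOf`; the others — `p ≠ 2`, `Addv W p`, `0 ≤ v_p(j)`, `p ∤ #tors`, `PRRatio W p ℒ` — are
not needed for (i)), from Gross–Zagier–Kolyvagin (`r_an ≤ 1 ⇒ rank = r_an`) and
`Kato2004.finite_descentCokernel_of_rankOne`. [cite: Kato2004Asterisque, §14.14 (14.14.1)–(14.14.2) (p. 243)]
[cite: Darmon2004, Thm. 3.22] -/
theorem rankOneCountReading_finite_of_gzk_of_finite_descentCokernel
    (hGZK : rank_eq_analyticRank_of_analyticRank_le_one)
    (hfd : Kato2004.finite_descentCokernel_of_rankOne)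
    (W : WeierstrassCurve ℚ) [W.IsElliptic] [W.IsGloballyMinimal] (p : ℕ) [Fact p.Prime]
    (D : KatoDescentDatum p) (hr : W.analyticRank = 1) (hfin : Finite W.sha)
    (hD : IsKatoZetaDescentDatumOfContra W p D) : Finite (coinvariants p D.H2) := by
  obtain ⟨hmw, -⟩ := hGZK W (by rw [hr])
  haveI := hfin
  exact finite_coinvariants_H2_of_isKatoZetaDescentDatumOfContra hfd hD (by rw [hmw, hr])
    (inferInstance : Finite (AddCommGroup.primaryComponent W.sha p))

/-- **`D.h2Card ≥ 1`** on such a datum (the order of the finite group `(D.H2)_Γ`; the shape in which the count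
(iii) of the reading divides by `#(D.H2)_Γ`). [cite: Kato2004Asterisque, §14.14 (14.14.2) (p. 243)] -/
theorem h2Card_pos_of_isKatoZetaDescentDatumOfContra
    (hfd : Kato2004.finite_descentCokernel_of_rankOne)
    {W : WeierstrassCurve ℚ} [W.IsElliptic] [W.IsGloballyMinimal] {p : ℕ} [Fact p.Prime]
    {D : KatoDescentDatum p} (hD : IsKatoZetaDescentDatumOfContra W p D)
    (hrank : W.mordellWeilRank = 1) (hsha : Finite (AddCommGroup.primaryComponent W.sha p)) :
    0 < D.h2Card :=
  D.h2Card_pos (finite_coinvariants_H2_of_isKatoZetaDescentDatumOfContra hfd hD hrank hsha)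

/-- **On such a datum Kato's Conjecture 12.10 (for the datum) forces `[A : z] = #(D.H2)_Γ`** (`μ = 1`; the tree's
descent `KatoDescentDatum.zetaIndex_eq_h2Card_of_conj1210` needs exactly the finiteness proved above) — the `m = 0`
case of the count (iii). [cite: Kato2004Asterisque, §14.14 and Lemma 14.15 (pp. 243–244), Conj. 12.10 (p. 224)] -/
theorem zetaIndex_eq_h2Card_of_isKatoZetaDescentDatumOfContra_of_conj1210
    (hfd : Kato2004.finite_descentCokernel_of_rankOne)
    {W : WeierstrassCurve ℚ} [W.IsElliptic] [W.IsGloballyMinimal] {p : ℕ} [Fact p.Prime]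
    {D : KatoDescentDatum p} (hD : IsKatoZetaDescentDatumOfContra W p D)
    (hrank : W.mordellWeilRank = 1) (hsha : Finite (AddCommGroup.primaryComponent W.sha p))
    (h1210 : D.Conj1210) : D.zetaIndex = D.h2Card :=
  D.zetaIndex_eq_h2Card_of_conj1210 (finite_coinvariants_H2_of_isKatoZetaDescentDatumOfContra hfd hD hrank hsha)
    h1210

/-- **… in particular under `KatoMainConjectureFineContra W p`** (the `→` half of `ReadsTrivialKMC` at the
contragredient closed binders, `conj1210_of_isKatoZetaDescentDatumOfContra_of_katoMainConjectureFineContra`,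
p628155): `[A : z] = #(D.H2)_Γ` on every realised datum of a rank-one `Ш[p^∞]`-finite row.
[cite: Kato2004Asterisque, Conj. 12.10 (p. 224), §14.14 (p. 243)] -/
theorem zetaIndex_eq_h2Card_of_isKatoZetaDescentDatumOfContra_of_kmcFineContra
    (hfd : Kato2004.finite_descentCokernel_of_rankOne)
    {W : WeierstrassCurve ℚ} [W.IsElliptic] [W.IsGloballyMinimal] {p : ℕ} [Fact p.Prime]
    {D : KatoDescentDatum p} (hD : IsKatoZetaDescentDatumOfContra W p D)
    (hrank : W.mordellWeilRank = 1) (hsha : Finite (AddCommGroup.primaryComponent W.sha p))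
    (hKMC : KatoMainConjectureFineContra W p) : D.zetaIndex = D.h2Card :=
  zetaIndex_eq_h2Card_of_isKatoZetaDescentDatumOfContra_of_conj1210 hfd hD hrank hsha
    (conj1210_of_isKatoZetaDescentDatumOfContra_of_katoMainConjectureFineContra hD hKMC)

end Summit.BirchSwinnertonDyer.Rank1Residual.Additive.ContraCount

end
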